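import Mathlib
import Summits.ValiantsHypothesis.ValiantsHypothesis.Theorems.NewtonTauWeak.Negative.Zonogon
import Summits.ValiantsHypothesis.ValiantsHypothesis.Theorems.NewtonUnitEquationsNewtonTauWeakSeparatedRank
import Summits.ValiantsHypothesis.ValiantsHypothesis.Theorems.NewtonUnitEquationsNewtonTauWeakHexagonTransfer
import Summits.ValiantsHypothesis.ValiantsHypothesis.Theorems.NewtonUnitEquationsNewtonTauWeakHexagonThree

/-!
# `NewtonUnitEquationsNewtonTauWeakHexagonDirections` — T2 for exponent lists on two lines (all `K`) and on
# three lines (`K = 3`)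

Rung toward `stub_binomialNewtonTauCommon` (T2 = KPTT Conj. 1 at `t = 2`; crux `NewtonTauWeak`,
stmt-ValiantsHypothesis-5904), line `binomial-normal-form`, lead c3 (card
`Cruxes/NewtonTauWeak/Lines/binomial-normal-form-delta-global.md`).

* `hex_binomialCommon_three_directions`: if every common exponent `d_j` is a multiple of one of three lattice
  vectors `uL, uR, uM ∈ ℕ²`, `uL, uR` independent and `rM·uM = rL·uL + rR·uR` with positive integers (the shape of
  ANY three pairwise independent directions of `ℕ²`, `uM` the middle one), then
  `vert(Σ_{l<3} c_l Π_j (1 - ρ_{lj}X^{d_j})) ≤ 5000`.  Proof: the integral linear map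
  `± diag(rR rM, rL rM)·adj[uL uR]` is injective and sends `uL, uR, uM` to multiples of `(1,0)`, `(0,1)`,
  `(1,1)`; transfer by `hex_vert_transfer`, conclude with `hex_binomialCommon_three_rays`.
* `hex_binomialCommon_two_directions`: on two independent lines, `vert ≤ 4K` for EVERY `K`: transfer along
  `± adj[uL uR]` to the axes and apply the separated-variables rank bound `vert_sum_mul_le_of_separated`
  (p89342), which it extends from axis-parallel digit frames to arbitrary pairs of lines. [folklore]
-/

set_option linter.dupNamespace false

noncomputable section

namespace Summit.ValiantsHypothesis.ValiantsHypothesis.Theorems.NewtonUnitEquationsNewtonTauWeak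

open scoped BigOperators
open MvPolynomial
open Summit.ValiantsHypothesis.ValiantsHypothesis.Theorems.NewtonTauWeak.Negative (vert)

namespace HexagonDirections

/-- The integral linear map `(x, y) ↦ (α (e x - c y), β (a y - b x))` of the plane (a scaled adjugate of the
matrix with columns `(a, b)`, `(c, e)`), as a real-linear map. [folklore] -/
theorem exists_linearMap (a b c e α β : ℝ) :
    ∃ L : (Fin 2 → ℝ) →ₗ[ℝ] (Fin 2 → ℝ), ∀ v : Fin 2 → ℝ,
      L v = ![α * (e * v 0 - c * v 1), β * (a * v 1 - b * v 0)] := by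
  refine ⟨{ toFun := fun v => ![α * (e * v 0 - c * v 1), β * (a * v 1 - b * v 0)],
            map_add' := ?_, map_smul' := ?_ }, fun v => rfl⟩
  · intro v w
    ext i; fin_cases i <;> simp <;> ring
  · intro r v
    ext i; fin_cases i <;> simp <;> ring

/-- Injectivity of that map when `α β (a e - b c) ≠ 0`. [folklore] -/
theorem injective_of_det {a b c e α β : ℝ} (hα : α ≠ 0) (hβ : β ≠ 0) (hdet : a * e - b * c ≠ 0)
    (L : (Fin 2 → ℝ) →ₗ[ℝ] (Fin 2 → ℝ))
    (hL : ∀ v : Fin 2 → ℝ, L v = ![α * (e * v 0 - c * v 1), β * (a * v 1 - b * v 0)]) :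
    Function.Injective L := by
  intro v w h
  rw [hL, hL] at h
  have h0 := congrFun h 0
  have h1 := congrFun h 1
  simp only [Matrix.cons_val_zero, Matrix.cons_val_one, Matrix.cons_val_fin_one] at h0 h1
  have h0' : e * v 0 - c * v 1 = e * w 0 - c * w 1 := mul_left_cancel₀ hα h0
  have h1' : a * v 1 - b * v 0 = a * w 1 - b * w 0 := mul_left_cancel₀ hβ h1
  have hx : (a * e - b * c) * (v 0 - w 0) = 0 := by linear_combination a * h0' + c * h1'
  have hy : (a * e - b * c) * (v 1 - w 1) = 0 := by linear_combination b * h0' + e * h1'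
  have hx' := (mul_eq_zero.mp hx).resolve_left hdet
  have hy' := (mul_eq_zero.mp hy).resolve_left hdet
  ext i; fin_cases i
  · exact sub_eq_zero.mp hx'
  · exact sub_eq_zero.mp hy'

end HexagonDirections

open HexagonDirections

/-- **T2 for `K = 3` on any three directions.** If every common exponent `d_j` is a multiple of one of three
lattice vectors `uL, uR, uM ∈ ℕ²` with `uL, uR` independent and `rM·uM = rL·uL + rR·uR` for positive integers
`rL, rR, rM` (i.e. `uM` points strictly into the cone of `uL, uR` — the configuration of any three pairwise
independent directions of `ℕ²`, the middle one being `uM`), then the binomial sum of three products has at most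
`5000` Newton vertices: transfer (`hex_vert_transfer`) along the integral linear map
`± diag(rR rM, rL rM)·adj[uL uR]`, which sends `uL, uR, uM` to multiples of `(1,0)`, `(0,1)`, `(1,1)`, then
`hex_binomialCommon_three_rays`. [folklore] -/
theorem hex_binomialCommon_three_directions (N : ℕ) (c : Fin 3 → ℂ) (ρ : Fin 3 → Fin N → ℂ)
    (d : Fin N → (Fin 2 →₀ ℕ)) (uL uR uM : Fin 2 →₀ ℕ) (rL rR rM : ℕ) (hrL : 0 < rL) (hrR : 0 < rR)
    (hrM : 0 < rM) (hrel : rM • uM = rL • uL + rR • uR) (hind : uL 0 * uR 1 ≠ uL 1 * uR 0)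
    (hd : ∀ j, (∃ k : ℕ, d j = k • uL) ∨ (∃ k : ℕ, d j = k • uR) ∨ (∃ k : ℕ, d j = k • uM)) :
    vert (∑ l, C (c l) * ∏ j, (1 - C (ρ l j) * monomial (d j) 1)) ≤ 5000 := by
  classical
  -- integer data
  set D : ℤ := ((uL 0 : ℕ) : ℤ) * ((uR 1 : ℕ) : ℤ) - ((uL 1 : ℕ) : ℤ) * ((uR 0 : ℕ) : ℤ) with hD
  have hD0 : D ≠ 0 := by
    intro h
    apply hind
    have : ((uL 0 : ℕ) : ℤ) * (uR 1 : ℕ) = ((uL 1 : ℕ) : ℤ) * (uR 0 : ℕ) := by linarith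
    exact_mod_cast this
  set σ : ℤ := Int.sign D with hσ
  have hσD : σ * D = |D| := Int.sign_mul_self_eq_abs D
  have hσ0 : σ ≠ 0 := fun h' => hD0 (Int.sign_eq_zero_iff_zero.mp h')
  set nD : ℕ := D.natAbs with hnD
  have hnD' : ((nD : ℕ) : ℤ) = |D| := Int.natCast_natAbs D
  -- the target exponents
  set vL : Fin 2 →₀ ℕ := Finsupp.single 0 (rR * rM * nD) with hvL
  set vR : Fin 2 →₀ ℕ := Finsupp.single 1 (rL * rM * nD) with hvR
  set vM : Fin 2 →₀ ℕ := Finsupp.single 0 (rL * rR * nD) + Finsupp.single 1 (rL * rR * nD) with hvM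
  set d' : Fin N → (Fin 2 →₀ ℕ) := fun j =>
    if h₁ : ∃ k : ℕ, d j = k • uL then Classical.choose h₁ • vL
    else if h₂ : ∃ k : ℕ, d j = k • uR then Classical.choose h₂ • vR
    else if h₃ : ∃ k : ℕ, d j = k • uM then Classical.choose h₃ • vM else 0 with hd'
  -- the real linear map
  set a : ℝ := ((uL 0 : ℕ) : ℝ) with ha
  set b : ℝ := ((uL 1 : ℕ) : ℝ) with hb
  set c' : ℝ := ((uR 0 : ℕ) : ℝ) with hc'
  set e : ℝ := ((uR 1 : ℕ) : ℝ) with he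
  set α : ℝ := ((σ : ℤ) : ℝ) * (rR : ℝ) * (rM : ℝ) with hα
  set β : ℝ := ((σ : ℤ) : ℝ) * (rL : ℝ) * (rM : ℝ) with hβ
  obtain ⟨L, hL⟩ := exists_linearMap a b c' e α β
  have hdetR : a * e - b * c' ≠ 0 := by
    have h : ((D : ℤ) : ℝ) ≠ 0 := by exact_mod_cast hD0
    have hDR : ((D : ℤ) : ℝ) = a * e - b * c' := by rw [hD]; push_cast; ring
    rwa [hDR] at h
  have hσR : ((σ : ℤ) : ℝ) ≠ 0 := by exact_mod_cast hσ0
  have hαR : α ≠ 0 := by positivity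
  have hβR : β ≠ 0 := by positivity
  have hLinj : Function.Injective L := injective_of_det hαR hβR hdetR L hL
  -- images of the three directions
  set emb : (Fin 2 →₀ ℕ) → (Fin 2 → ℝ) := fun v i => ((v i : ℕ) : ℝ) with hemb
  have hσDR : ((σ : ℤ) : ℝ) * (a * e - b * c') = (nD : ℝ) := by
    have h1 : (((σ * D : ℤ)) : ℝ) = ((|D| : ℤ) : ℝ) := by rw [hσD]
    have h2 : ((nD : ℕ) : ℝ) = ((|D| : ℤ) : ℝ) := by exact_mod_cast hnD'
    rw [h2, ← h1, hD]; push_cast; ring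
  have huL : emb uL = ![a, b] := by
    ext i; fin_cases i <;> simp [hemb, ha, hb]
  have huR : emb uR = ![c', e] := by
    ext i; fin_cases i <;> simp [hemb, hc', he]
  have hvL' : emb vL = ![(rR : ℝ) * (rM : ℝ) * (nD : ℝ), 0] := by
    ext i; fin_cases i <;> simp [hemb, hvL]
  have hvR' : emb vR = ![0, (rL : ℝ) * (rM : ℝ) * (nD : ℝ)] := by
    ext i; fin_cases i <;> simp [hemb, hvR]
  have hvM' : emb vM = ![(rL : ℝ) * (rR : ℝ) * (nD : ℝ), (rL : ℝ) * (rR : ℝ) * (nD : ℝ)] := by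
    ext i; fin_cases i <;> simp [hemb, hvM]
  have hLuL : L (emb uL) = emb vL := by
    rw [huL, hL, hvL']
    ext i; fin_cases i
    · simp only [Fin.zero_eta, Matrix.cons_val_zero, Matrix.cons_val_one, Matrix.cons_val_fin_one]
      rw [← hσDR, hα]; ring
    · simp only [Fin.mk_one, Matrix.cons_val_zero, Matrix.cons_val_one, Matrix.cons_val_fin_one]
      ring
  have hLuR : L (emb uR) = emb vR := by
    rw [huR, hL, hvR']
    ext i; fin_cases i
    · simp only [Fin.zero_eta, Matrix.cons_val_zero, Matrix.cons_val_one, Matrix.cons_val_fin_one]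
      ring
    · simp only [Fin.mk_one, Matrix.cons_val_zero, Matrix.cons_val_one, Matrix.cons_val_fin_one]
      rw [← hσDR, hβ]; ring
  have hembM : (rM : ℝ) • emb uM = (rL : ℝ) • emb uL + (rR : ℝ) • emb uR := by
    ext i
    have h := DFunLike.congr_fun hrel i
    simp only [Finsupp.smul_apply, Finsupp.add_apply, smul_eq_mul] at h
    simp only [hemb, Pi.smul_apply, Pi.add_apply, smul_eq_mul]
    exact_mod_cast h
  have hLuM : L (emb uM) = emb vM := by
    have hrM' : (rM : ℝ) ≠ 0 := by exact_mod_cast hrM.ne'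
    have h : (rM : ℝ) • L (emb uM) = (rM : ℝ) • emb vM := by
      rw [← map_smul, hembM, map_add, map_smul, map_smul, hLuL, hLuR, hvL', hvR', hvM']
      ext i; fin_cases i
      · simp only [Fin.zero_eta, Pi.add_apply, Pi.smul_apply, Matrix.cons_val_zero, smul_eq_mul]; ring
      · simp only [Fin.mk_one, Pi.add_apply, Pi.smul_apply, Matrix.cons_val_one, Matrix.cons_val_fin_one,
          smul_eq_mul]; ring
    exact smul_right_injective _ hrM' h
  have hemb_smul : ∀ (k : ℕ) (v : Fin 2 →₀ ℕ), emb (k • v) = (k : ℝ) • emb v := by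
    intro k v; ext i; simp [hemb]
  -- `L` carries `d j` to `d' j`, and `d' j` lies on one of the three model rays
  have hLd : ∀ j, L (emb (d j)) = emb (d' j) := by
    intro j
    simp only [hd']
    by_cases h₁ : ∃ k : ℕ, d j = k • uL
    · rw [dif_pos h₁]
      conv_lhs => rw [Classical.choose_spec h₁]
      rw [hemb_smul, map_smul, hLuL, hemb_smul]
    · rw [dif_neg h₁]
      by_cases h₂ : ∃ k : ℕ, d j = k • uR
      · rw [dif_pos h₂]
        conv_lhs => rw [Classical.choose_spec h₂]
        rw [hemb_smul, map_smul, hLuR, hemb_smul]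
      · rw [dif_neg h₂]
        have h₃ : ∃ k : ℕ, d j = k • uM := by
          rcases hd j with h | h | h
          · exact absurd h h₁
          · exact absurd h h₂
          · exact h
        rw [dif_pos h₃]
        conv_lhs => rw [Classical.choose_spec h₃]
        rw [hemb_smul, map_smul, hLuM, hemb_smul]
  have hrays : ∀ j, (d' j) 1 = 0 ∨ (d' j) 0 = 0 ∨ (d' j) 0 = (d' j) 1 := by
    intro j
    simp only [hd']
    split_ifs
    · left; simp [hvL]
    · right; left; simp [hvR]
    · right; right; simp [hvM]
    · left; simp
  rw [hex_vert_transfer 3 N c ρ d d' L hLinj hLd]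
  exact hex_binomialCommon_three_rays N c ρ d' hrays

namespace HexagonDirections

/-- A coordinate vanishing on the supports of all factors vanishes on the support of the product. [folklore] -/
theorem coord_eq_zero_of_prod {ι : Type*} (s : Finset ι) (f : ι → MvPolynomial (Fin 2) ℂ) (i : Fin 2)
    (hf : ∀ a ∈ s, ∀ e ∈ (f a).support, e i = 0) : ∀ e ∈ (∏ a ∈ s, f a).support, e i = 0 := by
  classical
  refine Finset.prod_induction f (fun p : MvPolynomial (Fin 2) ℂ => ∀ e ∈ p.support, e i = 0) ?_ ?_ hf
  · intro p q hp hq e he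
    obtain ⟨a, ha, b, hb, rfl⟩ := Finset.mem_add.mp (support_mul p q he)
    simp [hp a ha, hq b hb]
  · intro e he
    rw [← C_1, ← monomial_zero'] at he
    rw [Finset.mem_singleton.mp (support_monomial_subset he)]
    rfl

end HexagonDirections

/-- **T2 on two lines, all `K`.** If every common exponent `d_j` is a multiple of one of two independent lattice
vectors `uL, uR ∈ ℕ²`, then `vert(Σ_{l<K} c_l Π_j (1 - ρ_{lj}X^{d_j})) ≤ 4K` for EVERY `K` (uniformly in `N`, the
exponents and the coefficients): transfer along `± adj[uL uR]` to the axes (`hex_vert_transfer`), group the factors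
of each product into an x-only and a y-only part, and apply the separated-variables rank bound
`vert_sum_mul_le_of_separated` (p89342).  This extends that rung from axis-parallel digit frames to arbitrary pairs
of lines. [folklore] -/
theorem hex_binomialCommon_two_directions (K N : ℕ) (c : Fin K → ℂ) (ρ : Fin K → Fin N → ℂ)
    (d : Fin N → (Fin 2 →₀ ℕ)) (uL uR : Fin 2 →₀ ℕ) (hind : uL 0 * uR 1 ≠ uL 1 * uR 0)
    (hd : ∀ j, (∃ k : ℕ, d j = k • uL) ∨ (∃ k : ℕ, d j = k • uR)) :
    vert (∑ l, C (c l) * ∏ j, (1 - C (ρ l j) * monomial (d j) 1)) ≤ 4 * K := by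
  classical
  -- integer data
  set D : ℤ := ((uL 0 : ℕ) : ℤ) * ((uR 1 : ℕ) : ℤ) - ((uL 1 : ℕ) : ℤ) * ((uR 0 : ℕ) : ℤ) with hD
  have hD0 : D ≠ 0 := by
    intro h
    apply hind
    have : ((uL 0 : ℕ) : ℤ) * (uR 1 : ℕ) = ((uL 1 : ℕ) : ℤ) * (uR 0 : ℕ) := by linarith
    exact_mod_cast this
  set σ : ℤ := Int.sign D with hσ
  have hσD : σ * D = |D| := Int.sign_mul_self_eq_abs D
  have hσ0 : σ ≠ 0 := fun h' => hD0 (Int.sign_eq_zero_iff_zero.mp h')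
  set nD : ℕ := D.natAbs with hnD
  have hnD' : ((nD : ℕ) : ℤ) = |D| := Int.natCast_natAbs D
  set vL : Fin 2 →₀ ℕ := Finsupp.single 0 nD with hvL
  set vR : Fin 2 →₀ ℕ := Finsupp.single 1 nD with hvR
  set d' : Fin N → (Fin 2 →₀ ℕ) := fun j =>
    if h₁ : ∃ k : ℕ, d j = k • uL then Classical.choose h₁ • vL
    else if h₂ : ∃ k : ℕ, d j = k • uR then Classical.choose h₂ • vR else 0 with hd'
  set a : ℝ := ((uL 0 : ℕ) : ℝ) with ha
  set b : ℝ := ((uL 1 : ℕ) : ℝ) with hb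
  set c' : ℝ := ((uR 0 : ℕ) : ℝ) with hc'
  set e : ℝ := ((uR 1 : ℕ) : ℝ) with he
  obtain ⟨L, hL⟩ := exists_linearMap a b c' e ((σ : ℤ) : ℝ) ((σ : ℤ) : ℝ)
  have hdetR : a * e - b * c' ≠ 0 := by
    have h : ((D : ℤ) : ℝ) ≠ 0 := by exact_mod_cast hD0
    have hDR : ((D : ℤ) : ℝ) = a * e - b * c' := by rw [hD]; push_cast; ring
    rwa [hDR] at h
  have hσR : ((σ : ℤ) : ℝ) ≠ 0 := by exact_mod_cast hσ0
  have hLinj : Function.Injective L := injective_of_det hσR hσR hdetR L hL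
  set emb : (Fin 2 →₀ ℕ) → (Fin 2 → ℝ) := fun v i => ((v i : ℕ) : ℝ) with hemb
  have hσDR : ((σ : ℤ) : ℝ) * (a * e - b * c') = (nD : ℝ) := by
    have h1 : (((σ * D : ℤ)) : ℝ) = ((|D| : ℤ) : ℝ) := by rw [hσD]
    have h2 : ((nD : ℕ) : ℝ) = ((|D| : ℤ) : ℝ) := by exact_mod_cast hnD'
    rw [h2, ← h1, hD]; push_cast; ring
  have huL : emb uL = ![a, b] := by
    ext i; fin_cases i <;> simp [hemb, ha, hb]
  have huR : emb uR = ![c', e] := by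
    ext i; fin_cases i <;> simp [hemb, hc', he]
  have hvL' : emb vL = ![(nD : ℝ), 0] := by
    ext i; fin_cases i <;> simp [hemb, hvL]
  have hvR' : emb vR = ![0, (nD : ℝ)] := by
    ext i; fin_cases i <;> simp [hemb, hvR]
  have hLuL : L (emb uL) = emb vL := by
    rw [huL, hL, hvL']
    ext i; fin_cases i
    · simp only [Fin.zero_eta, Matrix.cons_val_zero, Matrix.cons_val_one, Matrix.cons_val_fin_one]
      linear_combination hσDR
    · simp only [Fin.mk_one, Matrix.cons_val_zero, Matrix.cons_val_one, Matrix.cons_val_fin_one]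
      ring
  have hLuR : L (emb uR) = emb vR := by
    rw [huR, hL, hvR']
    ext i; fin_cases i
    · simp only [Fin.zero_eta, Matrix.cons_val_zero, Matrix.cons_val_one, Matrix.cons_val_fin_one]
      ring
    · simp only [Fin.mk_one, Matrix.cons_val_zero, Matrix.cons_val_one, Matrix.cons_val_fin_one]
      linear_combination hσDR
  have hemb_smul : ∀ (k : ℕ) (v : Fin 2 →₀ ℕ), emb (k • v) = (k : ℝ) • emb v := by
    intro k v; ext i; simp [hemb]
  have hLd : ∀ j, L (emb (d j)) = emb (d' j) := by
    intro j
    simp only [hd']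
    by_cases h₁ : ∃ k : ℕ, d j = k • uL
    · rw [dif_pos h₁]
      conv_lhs => rw [Classical.choose_spec h₁]
      rw [hemb_smul, map_smul, hLuL, hemb_smul]
    · rw [dif_neg h₁]
      have h₂ : ∃ k : ℕ, d j = k • uR := (hd j).resolve_left h₁
      rw [dif_pos h₂]
      conv_lhs => rw [Classical.choose_spec h₂]
      rw [hemb_smul, map_smul, hLuR, hemb_smul]
  rw [hex_vert_transfer K N c ρ d d' L hLinj hLd]
  -- group the transferred factors: x-only and y-only
  set fac : Fin K → Fin N → MvPolynomial (Fin 2) ℂ := fun l j => 1 - C (ρ l j) * monomial (d' j) 1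
    with hfac
  set px : Fin N → Prop := fun j => ∃ k : ℕ, d j = k • uL with hpx
  set P : Fin K → MvPolynomial (Fin 2) ℂ := fun l => C (c l) * ∏ j ∈ Finset.univ.filter px, fac l j
    with hP
  set Q : Fin K → MvPolynomial (Fin 2) ℂ := fun l => ∏ j ∈ Finset.univ.filter (fun j => ¬ px j), fac l j
    with hQ
  have hsplit : ∀ l, C (c l) * ∏ j, fac l j = P l * Q l := by
    intro l
    simp only [hP, hQ]
    rw [← Finset.prod_filter_mul_prod_filter_not Finset.univ px]
    ring
  have hsum : (∑ l, C (c l) * ∏ j, (1 - C (ρ l j) * monomial (d' j) 1)) = ∑ l, P l * Q l :=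
    Finset.sum_congr rfl fun l _ => hsplit l
  rw [hsum]
  refine vert_sum_mul_le_of_separated K P Q (fun l => ?_) (fun l => ?_)
  · intro v hv
    obtain ⟨a₀, ha₀, b₀, hb₀, rfl⟩ := Finset.mem_add.mp (support_mul _ _ hv)
    rw [← monomial_zero'] at ha₀
    have ha0 : a₀ = 0 := Finset.mem_singleton.mp (support_monomial_subset ha₀)
    have hb1 : b₀ 1 = 0 := by
      refine HexagonDirections.coord_eq_zero_of_prod _ _ 1 (fun j hj w hw => ?_) b₀ hb₀
      rcases HexagonThree.mem_support_binomial hw with rfl | rfl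
      · rfl
      · have hj' : ∃ k : ℕ, d j = k • uL := (Finset.mem_filter.mp hj).2
        simp only [hd']
        rw [dif_pos hj']
        simp [hvL]
    simp [ha0, hb1]
  · refine HexagonDirections.coord_eq_zero_of_prod _ _ 0 (fun j hj w hw => ?_)
    rcases HexagonThree.mem_support_binomial hw with rfl | rfl
    · rfl
    · have hj' : ¬ ∃ k : ℕ, d j = k • uL := (Finset.mem_filter.mp hj).2
      have h₂ : ∃ k : ℕ, d j = k • uR := (hd j).resolve_left hj'
      simp only [hd']
      rw [dif_neg hj', dif_pos h₂]
      simp [hvR]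

end Summit.ValiantsHypothesis.ValiantsHypothesis.Theorems.NewtonUnitEquationsNewtonTauWeak

end
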